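import Summits.CriticalPhenomena.SAWScalingLimit.Theorems.SAWDefectDecoherenceBoundaryClosureRInnerPolygonsLocalCells
import Summits.CriticalPhenomena.SAWScalingLimit.Theorems.SAWDefectDecoherenceBoundaryClosureRInnerPolygonsWedges
import Summits.CriticalPhenomena.SAWScalingLimit.Theorems.SAWDefectDecoherenceBoundaryClosureRInnerPolygonsBoundaryWalk
import HarnessLib

/-!
# Crux `BoundaryClosureR` (stmt-CriticalPhenomena-14004), line `polygon-parity-squeeze`,
# stub `stub_innerZigzagPolygon` (7a): cells of `𝕋` round a vertex — closures, centres, and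
# wedges in the `closedHalfPlane` language

Landing target:
`Summits/CriticalPhenomena/SAWScalingLimit/Theorems/SAWDefectDecoherenceBoundaryClosureRInnerZigzagCells.lean`
(`--supports stmt-CriticalPhenomena-14004`; building block A1 of the registered stub
`stub_innerZigzagPolygon`, the continuum half of the inner-polygon construction (IP)).

The inner polygon is the inside of the boundary cycle of a pinch-free finite set `K` of faces of
the unit triangular lattice `𝕋 = triEmbed (Site 2)` (faces `HexVertex`, closed cells `triCell F`,
open cells `triCellStrict F` of `TriLatticeCells.lean`; the six faces round a vertex `y` are
`faceL y 0, …, faceL y 5` of `…InnerPolygonsBoundaryWalk.lean`).  This file collects the local cell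
geometry the identification of the inside uses:

* `hexCenter_mem_triCellStrict`, `triCell_subset_closure_triCellStrict` — a closed cell is the
  closure side of its (nonempty) open cell;
* `triEmbed_mem_triCell`, `edge_subset_triCell_left/right` — the closed edge of the dart `b → b + triDir m`
  lies in the closed cells of its left face `faceL b m` and of its right face `faceL b (m+5)`;
  `norm_sub_triEmbed_vertex_le` — a cell lies within `4` of each of its vertices; `exists_centre_vertex` —
  every face has a vertex on the index-`3` sublattice (its super-hexagon centre);
* `closedHalfPlane_vertex_iff`, `triCell_faceL_iff_wedge`, `exists_faceL_of_mem_triCell` — within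
  distance `1/4` of `triEmbed y` the `i`-th cell is the closed `60°` wedge
  `closedHalfPlane (a i) ∩ closedHalfPlane (b i)`, `a = ![2,3,5,3,2,4]`, `b = ![0,4,0,1,5,1]` (the
  dictionary of `fan_interiors`), and no other cell is met;

The open rhombus of two adjacent faces and the edge-local trichotomy are in the sequel
`…InnerZigzagEdges.lean`.

Sources: folklore plane geometry of the triangular lattice.  No proposition is defined and no
named fact is introduced.
-/

noncomputable section

open scoped ComplexConjugate
open Set
open Literature.Probability.LatticeModels
open Literature.Probability.Percolation (triX triY triCell triCellStrict cellForm triX_triEmbed triY_triEmbed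
  triX_add triY_add triX_sub triY_sub triX_smul triY_smul triX_hexCenter triY_hexCenter mem_triCell_iff
  mem_triCellStrict_iff cellForm_lineComb convex_triCell coords_of_mem_triCell triDir)
open Literature.Probability.RandomPlanarGeometry.SAW (site_two_eq_iff)
open Summit.CriticalPhenomena.SAWScalingLimit.Theorems.PolygonParitySqueeze.BoundaryWalk

namespace Summit.CriticalPhenomena.SAWScalingLimit.Theorems.PolygonParitySqueeze.InnerZigzag

/-! ### 1. The six faces round a vertex, closed cells and open cells -/

/-- The table `faceL y`, entrywise. [folklore] -/
theorem faceL_eq (y : Site 2) :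
    faceL y 0 = (y, 0) ∧ faceL y 1 = (y - Pi.single 0 1, 1) ∧ faceL y 2 = (y - Pi.single 0 1, 0) ∧
    faceL y 3 = (y - Pi.single 0 1 - Pi.single 1 1, 1) ∧ faceL y 4 = (y - Pi.single 1 1, 0) ∧
    faceL y 5 = (y - Pi.single 1 1, 1) := by
  simp [faceL]

/-- **The centre of a face lies in its open cell** (all three barycentric coordinates are `1/3`).
[folklore] -/
theorem hexCenter_mem_triCellStrict (F : HexVertex) : hexCenter F ∈ triCellStrict F := by
  obtain ⟨x, t⟩ := F
  intro j
  have hX := triX_hexCenter x t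
  have hY := triY_hexCenter x t
  fin_cases t <;> fin_cases j <;> simp [cellForm] at hX hY ⊢ <;> linarith

/-- **A closed cell lies in the closure of its open cell** (the open segment from a cell point to
the centre is in the open cell). [folklore] -/
theorem triCell_subset_closure_triCellStrict (F : HexVertex) : triCell F ⊆ closure (triCellStrict F) := by
  intro w hw
  have hc := hexCenter_mem_triCellStrict F
  have hopen : openSegment ℝ w (hexCenter F) ⊆ triCellStrict F := by
    rintro _ ⟨a, b, ha, hb, hab, rfl⟩ j
    rw [Complex.real_smul, Complex.real_smul, cellForm_lineComb F j hab]
    exact add_pos_of_nonneg_of_pos (mul_nonneg ha.le (hw j)) (mul_pos hb (hc j))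
  exact closure_mono hopen (segment_subset_closure_openSegment (left_mem_segment ℝ _ _))

/-- The vertices of a face lie in its closed cell. [folklore] -/
theorem triEmbed_mem_triCell {F : HexVertex} {v : Site 2} (hv : v ∈ hexFaceVertices F) :
    triEmbed v ∈ triCell F := by
  obtain ⟨x, t⟩ := F
  intro j
  fin_cases t <;> simp [hexFaceVertices] at hv <;> rcases hv with rfl | rfl | rfl <;> fin_cases j <;>
    simp [cellForm, triX_triEmbed, triY_triEmbed] <;> linarith

/-- A segment between two vertices of a face lies in its closed cell. [folklore] -/
theorem segment_subset_triCell {F : HexVertex} {v w : Site 2} (hv : v ∈ hexFaceVertices F)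
    (hw : w ∈ hexFaceVertices F) : segment ℝ (triEmbed v) (triEmbed w) ⊆ triCell F :=
  (convex_triCell F).segment_subset (triEmbed_mem_triCell hv) (triEmbed_mem_triCell hw)

/-- **The closed edge of the dart `b → b + triDir m` lies in the closed cell of its left face.**
[folklore] -/
theorem edge_subset_triCell_left (b : Site 2) (m : Fin 6) :
    segment ℝ (triEmbed b) (triEmbed (b + triDir m)) ⊆ triCell (faceL b m) := by
  apply segment_subset_triCell <;> rw [hexFaceVertices_faceL] <;> simp

/-- **… and in the closed cell of its right face `faceL b (m+5)`.** [folklore] -/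
theorem edge_subset_triCell_right (b : Site 2) (m : Fin 6) :
    segment ℝ (triEmbed b) (triEmbed (b + triDir m)) ⊆ triCell (faceL b (m + 5)) := by
  have e : m + 5 + 1 = m := by rw [add_assoc, show (5 : Fin 6) + 1 = 0 from rfl, add_zero]
  apply segment_subset_triCell <;> rw [hexFaceVertices_faceL] <;> simp [e]

/-- A closed cell lies within `4` of each of its vertices (crude). [folklore] -/
theorem norm_sub_triEmbed_vertex_le {F : HexVertex} {w : ℂ} {v : Site 2} (hw : w ∈ triCell F)
    (hv : v ∈ hexFaceVertices F) : ‖w - triEmbed v‖ ≤ 4 := by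
  have h1 := Literature.Probability.Percolation.norm_sub_triEmbed_le_of_mem_triCell hw
  have h2 := Literature.Probability.Percolation.norm_sub_triEmbed_le_of_mem_triCell (triEmbed_mem_triCell hv)
  calc ‖w - triEmbed v‖ = ‖(w - triEmbed F.1) - (triEmbed v - triEmbed F.1)‖ := by ring_nf
    _ ≤ ‖w - triEmbed F.1‖ + ‖triEmbed v - triEmbed F.1‖ := norm_sub_le _ _
    _ ≤ 4 := by linarith

/-- **Every face has a vertex on the index-`3` sublattice `c₀ ≡ c₁ (mod 3)`** (the centre of its
super-hexagon tile). [folklore] -/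
theorem exists_centre_vertex (F : HexVertex) : ∃ c ∈ hexFaceVertices F, (c 0 - c 1) % 3 = 0 := by
  obtain ⟨x, t⟩ := F
  have h3 : (x 0 - x 1) % 3 = 0 ∨ (x 0 - x 1) % 3 = 1 ∨ (x 0 - x 1) % 3 = 2 := by omega
  fin_cases t
  · rcases h3 with h | h | h
    · exact ⟨x, by simp [hexFaceVertices], h⟩
    · exact ⟨x + Pi.single 1 1, by simp [hexFaceVertices], by simp; omega⟩
    · exact ⟨x + Pi.single 0 1, by simp [hexFaceVertices], by simp; omega⟩
  · rcases h3 with h | h | h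
    · exact ⟨x + Pi.single 0 1 + Pi.single 1 1, by simp [hexFaceVertices], by simp; omega⟩
    · exact ⟨x + Pi.single 1 1, by simp [hexFaceVertices], by simp; omega⟩
    · exact ⟨x + Pi.single 0 1, by simp [hexFaceVertices], by simp; omega⟩

/-! ### 2. Wedges round a vertex in the `closedHalfPlane` language -/

/-- **The six signed levels relative to a vertex are the relative lattice coordinates**:
`ℓ₀ = (√3/2)Y'`, `ℓ₂ = (√3/2)X'`, `ℓ₄ = (√3/2)(X'+Y')`, `ℓ₁ = -ℓ₀`, `ℓ₃ = -ℓ₂`, `ℓ₅ = -ℓ₄`, with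
`X' = X(w) - y₀`, `Y' = Y(w) - y₁`. [folklore] -/
theorem level_sub_triEmbed (w : ℂ) (y : Site 2) :
    ((w - triEmbed y) * conj (innerNormal 0)).re = Real.sqrt 3 / 2 * (triY w - y 1) ∧
    ((w - triEmbed y) * conj (innerNormal 1)).re = -(Real.sqrt 3 / 2 * (triY w - y 1)) ∧
    ((w - triEmbed y) * conj (innerNormal 2)).re = Real.sqrt 3 / 2 * (triX w - y 0) ∧
    ((w - triEmbed y) * conj (innerNormal 3)).re = -(Real.sqrt 3 / 2 * (triX w - y 0)) ∧
    ((w - triEmbed y) * conj (innerNormal 4)).re = Real.sqrt 3 / 2 * ((triX w - y 0) + (triY w - y 1)) ∧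
    ((w - triEmbed y) * conj (innerNormal 5)).re = -(Real.sqrt 3 / 2 * ((triX w - y 0) + (triY w - y 1))) := by
  obtain ⟨h1, h3, h5⟩ := level_odd_eq_neg (w - triEmbed y)
  rw [h1, h3, h5, level_eq_triY, level_eq_triX, level_eq_triX_add_triY, triX_sub, triY_sub, triX_triEmbed,
    triY_triEmbed]
  exact ⟨rfl, rfl, rfl, rfl, rfl, rfl⟩

/-- `√3/2 > 0`. [folklore] -/
theorem sqrt_three_div_two_pos : (0 : ℝ) < Real.sqrt 3 / 2 := by positivity

/-- **Closed zigzag half-planes through a vertex in lattice coordinates.** [folklore] -/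
theorem closedHalfPlane_vertex_iff (y : Site 2) (w : ℂ) :
    (w ∈ closedHalfPlane 0 (triEmbed y) ↔ 0 ≤ triY w - y 1) ∧
    (w ∈ closedHalfPlane 1 (triEmbed y) ↔ triY w - y 1 ≤ 0) ∧
    (w ∈ closedHalfPlane 2 (triEmbed y) ↔ 0 ≤ triX w - y 0) ∧
    (w ∈ closedHalfPlane 3 (triEmbed y) ↔ triX w - y 0 ≤ 0) ∧
    (w ∈ closedHalfPlane 4 (triEmbed y) ↔ 0 ≤ (triX w - y 0) + (triY w - y 1)) ∧
    (w ∈ closedHalfPlane 5 (triEmbed y) ↔ (triX w - y 0) + (triY w - y 1) ≤ 0) := by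
  obtain ⟨h0, h1, h2, h3, h4, h5⟩ := level_sub_triEmbed w y
  have hs := sqrt_three_div_two_pos
  simp only [mem_closedHalfPlane, h0, h1, h2, h3, h4, h5]
  refine ⟨?_, ?_, ?_, ?_, ?_, ?_⟩ <;> constructor <;> intro h <;> nlinarith

/-- **Open zigzag half-planes through a vertex in lattice coordinates.** [folklore] -/
theorem halfPlane_vertex_iff (y : Site 2) (w : ℂ) :
    (w ∈ halfPlane 0 (triEmbed y) ↔ 0 < triY w - y 1) ∧
    (w ∈ halfPlane 1 (triEmbed y) ↔ triY w - y 1 < 0) ∧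
    (w ∈ halfPlane 2 (triEmbed y) ↔ 0 < triX w - y 0) ∧
    (w ∈ halfPlane 3 (triEmbed y) ↔ triX w - y 0 < 0) ∧
    (w ∈ halfPlane 4 (triEmbed y) ↔ 0 < (triX w - y 0) + (triY w - y 1)) ∧
    (w ∈ halfPlane 5 (triEmbed y) ↔ (triX w - y 0) + (triY w - y 1) < 0) := by
  obtain ⟨h0, h1, h2, h3, h4, h5⟩ := level_sub_triEmbed w y
  have hs := sqrt_three_div_two_pos
  simp only [mem_halfPlane_iff_level, h0, h1, h2, h3, h4, h5]
  refine ⟨?_, ?_, ?_, ?_, ?_, ?_⟩ <;> constructor <;> intro h <;> nlinarith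

/-- **Near a vertex the `i`-th cell is the `i`-th closed wedge** `closedHalfPlane (a i) ∩ closedHalfPlane (b i)`,
`a = ![2,3,5,3,2,4]`, `b = ![0,4,0,1,5,1]` (the dictionary of `fan_interiors`). [folklore] -/
theorem triCell_faceL_iff_wedge (y : Site 2) (w : ℂ) (hw : ‖w - triEmbed y‖ < 1 / 4) (i : Fin 6) :
    w ∈ triCell (faceL y i) ↔
      w ∈ closedHalfPlane (![2, 3, 5, 3, 2, 4] i) (triEmbed y) ∩ closedHalfPlane (![0, 4, 0, 1, 5, 1] i) (triEmbed y) := by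
  obtain ⟨c0, c1, c2, c3, c4, c5⟩ := mem_triCell_vertexFace_iff y w hw
  obtain ⟨h0, h1, h2, h3, h4, h5⟩ := closedHalfPlane_vertex_iff y w
  obtain ⟨f0, f1, f2, f3, f4, f5⟩ := faceL_eq y
  fin_cases i
  · show w ∈ triCell (faceL y 0) ↔ w ∈ closedHalfPlane 2 (triEmbed y) ∩ closedHalfPlane 0 (triEmbed y)
    rw [f0, mem_inter_iff, c0, h2, h0]
  · show w ∈ triCell (faceL y 1) ↔ w ∈ closedHalfPlane 3 (triEmbed y) ∩ closedHalfPlane 4 (triEmbed y)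
    rw [f1, mem_inter_iff, c1, h3, h4]
  · show w ∈ triCell (faceL y 2) ↔ w ∈ closedHalfPlane 5 (triEmbed y) ∩ closedHalfPlane 0 (triEmbed y)
    rw [f2, mem_inter_iff, c2, h5, h0]
  · show w ∈ triCell (faceL y 3) ↔ w ∈ closedHalfPlane 3 (triEmbed y) ∩ closedHalfPlane 1 (triEmbed y)
    rw [f3, mem_inter_iff, c3, h3, h1]
  · show w ∈ triCell (faceL y 4) ↔ w ∈ closedHalfPlane 2 (triEmbed y) ∩ closedHalfPlane 5 (triEmbed y)
    rw [f4, mem_inter_iff, c4, h2, h5]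
  · show w ∈ triCell (faceL y 5) ↔ w ∈ closedHalfPlane 4 (triEmbed y) ∩ closedHalfPlane 1 (triEmbed y)
    rw [f5, mem_inter_iff, c5, h4, h1, and_comm]

/-- **Every cell met within `1/4` of a vertex is one of the six round it.** [folklore] -/
theorem exists_faceL_of_mem_triCell (y : Site 2) (w : ℂ) (hw : ‖w - triEmbed y‖ < 1 / 4) (G : HexVertex)
    (hG : w ∈ triCell G) : ∃ i : Fin 6, G = faceL y i := by
  obtain ⟨f0, f1, f2, f3, f4, f5⟩ := faceL_eq y
  rcases vertexFace_of_mem_triCell y w hw G hG with h | h | h | h | h | h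
  · exact ⟨0, h.trans f0.symm⟩
  · exact ⟨1, h.trans f1.symm⟩
  · exact ⟨2, h.trans f2.symm⟩
  · exact ⟨3, h.trans f3.symm⟩
  · exact ⟨4, h.trans f4.symm⟩
  · exact ⟨5, h.trans f5.symm⟩

/-- **Cells round a vertex** (registered form, sub-goal of `stub_innerZigzagPolygon`): within
distance `1/4` of `triEmbed y` the `i`-th cell round `y` is the `i`-th closed zigzag wedge, and no
other cell is met. [folklore] -/
theorem cells_round_vertex : ∀ (y : Site 2) (w : ℂ), ‖w - triEmbed y‖ < 1 / 4 → (∀ i : Fin 6, w ∈ triCell (faceL y i) ↔ w ∈ closedHalfPlane (![2, 3, 5, 3, 2, 4] i) (triEmbed y) ∩ closedHalfPlane (![0, 4, 0, 1, 5, 1] i) (triEmbed y)) ∧ ∀ G : HexVertex, w ∈ triCell G → ∃ i : Fin 6, G = faceL y i :=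
  fun y w hw => ⟨fun i => triCell_faceL_iff_wedge y w hw i, exists_faceL_of_mem_triCell y w hw⟩

end Summit.CriticalPhenomena.SAWScalingLimit.Theorems.PolygonParitySqueeze.InnerZigzag

end
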